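import Mathlib
import Summits.Ventures.HodgeRepro2.HeckeSlashDoubleCoset

/-!
# HeckeSlashNormalizer — Hecke operators of elements normalising `S` (Atkin–Lehner type):
`T_δ f = f ∥_k δ`, and `T_δ ∘ T_δ = id` for an involution

Blind cell `pub-hodge-repro2`, seat p2 (Tier 5 kernel support, Hecke side).

For `δ ∈ U(H)(K)` normalising `S` (`s ∈ S ↔ δ s δ⁻¹ ∈ S`) the subgroup `S_δ = S ∩ δ⁻¹Sδ` is `S`
itself, the coset space `S/S_δ` is a point, and the Hecke operator is the single slash
`T_δ f = f ∥_k δ`. If moreover `δ² = 1`, `T_δ` is an involution on the weight-`k` forms. Such `δ`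
give the simplest self-adjoint Hecke operators: `δ² ∈ S ⇒ δ⁻¹ ∈ SδS` (so `T_δ = T_{δ⁻¹}` by
`DoubleCosetMem.lean`).

* `heckeSubgroup_eq_of_normalizes`, `subsingleton_heckeQuotient_of_normalizes`;
* **`hecke_eq_slash_of_normalizes`**: `T_δ f z = (f ∥_k δ) z` on the ball;
* **`hecke_hecke_eq_self_of_normalizes_of_sq_eq_one`**: `T_δ (T_δ f) z = f z` on the ball when
  `δ² = 1`;
* `inv_mem_doubleCoset_of_sq_mem`: `δ² ∈ S ⇒ δ⁻¹ ∈ SδS`.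
-/

namespace Summit.Ventures.HodgeRepro2.ShimuraData

open Finset

variable {K : Type*} [Field K] {S : Subgroup (GL (Fin 3) K)} {δ : GL (Fin 3) K}

/-- If `δ` normalises `S` then `S_δ = S`. -/
theorem heckeSubgroup_eq_of_normalizes (hδ : ∀ s, s ∈ S ↔ δ * s * δ⁻¹ ∈ S) :
    heckeSubgroup S δ = S := by
  ext γ
  rw [mem_heckeSubgroup]
  exact ⟨fun h => h.1, fun h => ⟨h, (hδ γ).mp h⟩⟩

/-- If `δ` normalises `S` then `S / S_δ` is a point. -/
theorem subsingleton_heckeQuotient_of_normalizes (hδ : ∀ s, s ∈ S ↔ δ * s * δ⁻¹ ∈ S) :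
    Subsingleton (S ⧸ (heckeSubgroup S δ).subgroupOf S) := by
  rw [heckeSubgroup_eq_of_normalizes hδ, Subgroup.subgroupOf_self]
  exact QuotientGroup.subsingleton_quotient_top

/-- `δ² ∈ S ⇒ δ⁻¹ ∈ S δ S`. -/
theorem inv_mem_doubleCoset_of_sq_mem (h : δ * δ ∈ S) : δ⁻¹ ∈ doubleCoset S δ :=
  ⟨1, one_mem _, (δ * δ)⁻¹, inv_mem h, by group⟩

variable [NumberField K] [NumberField.IsCMField K] {τ₁ : K →+* ℂ} {H : Matrix (Fin 3) (Fin 3) K}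
  {Q : Matrix (Fin 3) (Fin 3) ℂ}

/-- **`T_δ f = f ∥_k δ` for `δ` normalising `S`** (on the ball). -/
theorem hecke_eq_slash_of_normalizes (hQ : IsFrame K τ₁ H Q)
    (hS : (S : Set (GL (Fin 3) K)) ⊆ unitaryGroup K H) (hδ : ∀ s, s ∈ S ↔ δ * s * δ⁻¹ ∈ S)
    (hδU : δ ∈ unitaryGroup K H) [Fintype (S ⧸ (heckeSubgroup S δ).subgroupOf S)] {k : ℕ}
    {f : (Fin 2 → ℂ) → ℂ} (hf : IsWeightFor τ₁ Q S k f) {z : Fin 2 → ℂ} (hz : z ∈ ball₂) :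
    hecke S δ τ₁ Q k f z = slash k (realEmbedding K τ₁ Q δ) f z := by
  haveI := subsingleton_heckeQuotient_of_normalizes hδ
  simp only [hecke]
  rw [Fintype.sum_subsingleton _ (QuotientGroup.mk (1 : S))]
  set r : S := heckeRep S δ (QuotientGroup.mk (1 : S)) with hr
  have hγ : δ * (r : GL (Fin 3) K) * δ⁻¹ ∈ S := (hδ r).mp r.2
  have hsplit : δ * (r : GL (Fin 3) K) = δ * (r : GL (Fin 3) K) * δ⁻¹ * δ := by group
  rw [hsplit]
  exact slash_realEmbedding_mul_left hQ hS hf hγ hδU hz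

/-- **`T_δ` is an involution** on the weight-`k` forms (on the ball) for `δ` normalising `S` with
`δ² = 1`. -/
theorem hecke_hecke_eq_self_of_normalizes_of_sq_eq_one (hQ : IsFrame K τ₁ H Q)
    (hS : (S : Set (GL (Fin 3) K)) ⊆ unitaryGroup K H) (hδ : ∀ s, s ∈ S ↔ δ * s * δ⁻¹ ∈ S)
    (hδU : δ ∈ unitaryGroup K H) (hδδ : δ * δ = 1)
    [Fintype (S ⧸ (heckeSubgroup S δ).subgroupOf S)] {k : ℕ}
    {f : (Fin 2 → ℂ) → ℂ} (hf : IsWeightFor τ₁ Q S k f) {z : Fin 2 → ℂ} (hz : z ∈ ball₂) :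
    hecke S δ τ₁ Q k (hecke S δ τ₁ Q k f) z = f z := by
  have hU : IsInU21 (realEmbedding K τ₁ Q δ) := hQ.isInU21_realEmbedding hδU
  have hw : ballAction (realEmbedding K τ₁ Q δ) z ∈ ball₂ := hU.ballAction_mem_ball₂ hz
  rw [hecke_eq_slash_of_normalizes hQ hS hδ hδU (IsWeightFor.hecke hQ S hS hδU hf) hz]
  -- `(T_δ f)(δ z) = (f ∥ δ)(δ z)`
  have h1 : slash k (realEmbedding K τ₁ Q δ) (hecke S δ τ₁ Q k f) z
      = slash k (realEmbedding K τ₁ Q δ) (slash k (realEmbedding K τ₁ Q δ) f) z := by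
    simp only [slash]
    rw [hecke_eq_slash_of_normalizes hQ hS hδ hδU hf hw]
    rfl
  rw [h1, ← slash_mul k hU f hz, ← hQ.realEmbedding_mul, hδδ, hQ.realEmbedding_one, slash_one]

end Summit.Ventures.HodgeRepro2.ShimuraData
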